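import Summits.Schanuel.Schanuel.Theorems.ZilberEacGraphSurfaceLogRootSeq
import HarnessLib

/-!
# Non-split surfaces over a graph base, IV: the escape engine with polynomial coefficients and a
# LOGARITHMIC balance (unbalanced edges)

HONEST FRAMING.  Cell `pub-schanuel` (Zilber's Exponential-Algebraic Closedness, case ladder;
host summit Schanuel), seat 2, gen 17.  Engine v3 for `g(z) = Σ_j q_j(z) e^{e_j R(z)} + E(z)`
(`q_j ∈ ℂ[z]`, `deg R ≥ 2`) WITHOUT the balance hypothesis of `exists_escape_zeros_poly` (v2):
for a slope `μ` and height `κ` with `deg q_j + μ e_j ≤ κ` and top polynomial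
`Q_μ(v) = Σ_{=κ} lc(q_j) v^{e_j}` having a root `θ ≠ 0`, work along the exact roots `z₀` of
`R(z₀) - μ L = 2πiN + log θ`, `e^{L} = z₀` (`exists_alRoot_log_seq`): in the local coordinate
`φ(u) = z₀ e^{u/(dT')}` one has `e^{R} = θ e^{μL} e^{u + Rem}`, and `G_k(u) = g(φ_k u)/e^{κ L_k}`
converges to `Q_μ(θ e^{u})` uniformly on the unit disc (top terms: EXACT factor
`e^{(deg q_j + μ e_j - κ)L} = 1`; other terms: `‖z₀‖^{deg q_j + μ e_j - κ} → 0`; `E/e^{κL}`: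
exponentially small); Hurwitz persistence.  With `μ = 0` this is v2.  NOT Schanuel's conjecture
(neither used nor implied; EAC ⇏ SC); `EC(3,2)` stays OPEN; the density theorems built on this
engine are instances of Mantova–Masser's OPEN question (PLMS 2024, §1 p. 5).
-/

noncomputable section

open Filter Topology Metric Set Complex Polynomial
open Literature.ModelTheory.Zilber

set_option linter.dupNamespace false

namespace Summit.Schanuel.Schanuel.Theorems

/-! ## Part B. The engine -/

/-- **Escaping zeros of `Σ_j q_j(z) e^{e_j R(z)} + E(z)` — logarithmic balance.**  `R` of degree
`≥ 2`; `q_j ∈ ℂ[z]`, exponents `e_j ∈ ℕ` (`j ∈ J`); reals `μ, κ` with `deg q_j + μ e_j ≤ κ` on `J`;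
the top polynomial `Σ_{deg q_j + μ e_j = κ} lc(q_j) X^{e_j}` is nonzero with a root `θ ≠ 0`; `E`
entire with `‖E(z)‖ ≤ C_B (1 + ‖z‖)^N e^{δ Re z}` whenever `Re z ≤ 0`, `‖z‖ ≥ 1` and
`|Re R(z) - μ log ‖z‖| ≤ B`.  Then there are zeros `z_k` with `Re z_k ≤ -L_k`, `‖z_k‖ ≤ 16 L_k + 17`,
`L_k → ∞`. (new) -/
theorem exists_escape_zeros_log {ι : Type*} (R : Polynomial ℂ) (hd : 2 ≤ R.natDegree)
    (J : Finset ι) (q : ι → Polynomial ℂ) (e : ι → ℕ) (μ κ : ℝ)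
    (hκ : ∀ j ∈ J, ((q j).natDegree : ℝ) + μ * e j ≤ κ)
    {θ : ℂ} (hθ0 : θ ≠ 0)
    (hθ : (∑ j ∈ J.filter (fun j => ((q j).natDegree : ℝ) + μ * e j = κ),
        Polynomial.C (q j).leadingCoeff * Polynomial.X ^ (e j)).eval θ = 0)
    (hQ : (∑ j ∈ J.filter (fun j => ((q j).natDegree : ℝ) + μ * e j = κ),
        Polynomial.C (q j).leadingCoeff * Polynomial.X ^ (e j)) ≠ 0)
    (E : ℂ → ℂ) (hE : Differentiable ℂ E) {δ : ℝ} (hδ : 0 < δ)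
    (hEb : ∀ B : ℝ, ∃ C : ℝ, 0 ≤ C ∧ ∃ N : ℕ, ∀ z : ℂ, z.re ≤ 0 → 1 ≤ ‖z‖ →
      |(R.eval z).re - μ * Real.log ‖z‖| ≤ B →
        ‖E z‖ ≤ C * (1 + ‖z‖) ^ N * Real.exp (δ * z.re)) :
    ∃ (z : ℕ → ℂ) (L : ℕ → ℝ), Tendsto L atTop atTop ∧
      ∀ k, (∑ j ∈ J, (q j).eval (z k) * exp (R.eval (z k)) ^ (e j)) + E (z k) = 0 ∧
        (z k).re ≤ -L k ∧ ‖z k‖ ≤ 16 * L k + 17 := by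
  classical
  -- notation
  set Jt := J.filter (fun j => ((q j).natDegree : ℝ) + μ * e j = κ) with hJt
  set Jn := J.filter (fun j => ¬ ((q j).natDegree : ℝ) + μ * e j = κ) with hJn
  set Qμ : Polynomial ℂ := ∑ j ∈ Jt, Polynomial.C (q j).leadingCoeff * Polynomial.X ^ (e j)
    with hQμ
  set a : ℂ := R.leadingCoeff with ha_def
  set ℓ : Polynomial ℂ := R.eraseLead with hℓ_def
  set d : ℕ := R.natDegree with hd_def
  -- the limit function `h(u) = Q_μ(θ e^u)`
  set h : ℂ → ℂ := fun u => Qμ.eval (θ * exp u) with hh_def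
  have hh : Differentiable ℂ h :=
    (Polynomial.differentiable Qμ).comp ((differentiable_const θ).mul differentiable_exp)
  have hh0 : h 0 = 0 := by simp only [hh_def, Complex.exp_zero, mul_one]; exact hθ
  have hhne : ∃ u, h u ≠ 0 := exists_eval_mul_exp_ne_zero hQ hθ0
  -- the corrected roots
  obtain ⟨Λ, z₀, Lg, hΛ, hroot⟩ := exists_alRoot_log_seq R hd hθ0 μ
  have hLz : ∀ j, exp (Lg j) = z₀ j := fun j => (hroot j).1
  have hz₀θ : ∀ j, exp (R.eval (z₀ j)) = θ * exp ((μ : ℂ) * Lg j) := fun j => (hroot j).2.1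
  have hz₀re := fun j => (hroot j).2.2.1
  have hz₀1 : ∀ j, 1 ≤ ‖z₀ j‖ := fun j => (hroot j).2.2.2.1
  have hz₀2 : ∀ j, 2 ≤ ‖a‖ * ‖z₀ j‖ := fun j => (hroot j).2.2.2.2.1
  have hz₀neg : ∀ j, (z₀ j).re ≤ -(3 / 16) * Λ j := fun j => (hroot j).2.2.2.2.2.1
  have hz₀up : ∀ j, ‖z₀ j‖ ≤ 3 * Λ j := fun j => (hroot j).2.2.2.2.2.2.1
  have hz₀nonpos : ∀ j, (z₀ j).re + 1 ≤ 0 := fun j => (hroot j).2.2.2.2.2.2.2.1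
  have hz₀16 : ∀ j, 16 ≤ ‖z₀ j‖ := fun j => (hroot j).2.2.2.2.2.2.2.2
  have hapos : 0 < ‖a‖ := by
    rcases (norm_nonneg a).eq_or_lt with h0 | h0
    · have := hz₀2 0; rw [← h0, zero_mul] at this; linarith
    exact h0
  have hΛ0 : ∀ j, 0 ≤ Λ j := fun j => by linarith [hz₀up j, norm_nonneg (z₀ j)]
  have hz₀ne : ∀ j, z₀ j ≠ 0 := fun j => norm_pos_iff.1 (by linarith [hz₀1 j])
  have hReL : ∀ j, (Lg j).re = Real.log ‖z₀ j‖ := fun j => re_eq_log_norm_of_exp_eq (hLz j)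
  have hlog0 : ∀ j, 0 ≤ Real.log ‖z₀ j‖ := fun j => Real.log_nonneg (hz₀1 j)
  -- the remainder constant and the local coordinates
  set K : ℝ := 1 / ‖a‖ + coeffNormSum ℓ * ((d - 1 : ℕ) : ℝ) * 2 ^ (d - 1) / ‖a‖ with hK_def
  have hK0 : 0 ≤ K := by have := coeffNormSum_nonneg ℓ; positivity
  set φ : ℕ → ℂ → ℂ := fun j u =>
    z₀ j * exp (u / ((R.natDegree : ℂ) * (R.leadingCoeff * z₀ j ^ R.natDegree))) with hφ_def
  have hRem : ∀ j (u : ℂ), ‖u‖ ≤ 1 → ‖R.eval (φ j u) - R.eval (z₀ j) - u‖ ≤ K / ‖z₀ j‖ :=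
    fun j u hu => norm_gceRem_le hd (hz₀1 j) (hz₀2 j) hu
  have hdisp : ∀ j (u : ℂ), ‖u‖ ≤ 1 → ‖φ j u - z₀ j‖ ≤ 1 := fun j u hu => by
    obtain ⟨h1, h2⟩ := norm_gcePhi_sub_le (R := R) (z₀ := z₀ j) hd (hz₀1 j) (hz₀2 j) hu
    exact h1.trans h2
  have hz₀norm : Tendsto (fun j => ‖z₀ j‖) atTop atTop := by
    refine tendsto_atTop_mono (fun j => ?_) (hΛ.const_mul_atTop (by norm_num : (0 : ℝ) < 3 / 16))
    have h1 := hz₀neg j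
    have h2 := abs_re_le_norm (z₀ j)
    have h3 : -(z₀ j).re ≤ |(z₀ j).re| := neg_le_abs _
    linarith
  have hlog : Tendsto (fun j => Real.log ‖z₀ j‖) atTop atTop :=
    Real.tendsto_log_atTop.comp hz₀norm
  -- coefficient ratios: `‖q_j(φ u)/z₀^{n_j} - lc(q_j)‖ ≤ K_j/‖z₀‖`
  set Kq : ι → ℝ := fun j =>
    (coeffNormSum (q j) + coeffNormSum (q j).eraseLead +
      (q j).natDegree * ‖(q j).leadingCoeff‖) * 2 ^ (q j).natDegree with hKq
  have hKq0 : ∀ j, 0 ≤ Kq j := fun j => by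
    have := coeffNormSum_nonneg (q j); have := coeffNormSum_nonneg (q j).eraseLead
    simp only [hKq]; positivity
  have hratio : ∀ j i (u : ℂ), ‖u‖ ≤ 1 →
      ‖(q j).eval (φ i u) / z₀ i ^ (q j).natDegree - (q j).leadingCoeff‖ ≤ Kq j / ‖z₀ i‖ :=
    fun j i u hu => norm_eval_div_pow_sub_coeff_le (q j) le_rfl (hz₀1 i) (hdisp i u hu)
  -- the normalisers `D_i = e^{κ L_i}` and the weights `F_{ij} = e^{(n_j + μ e_j - κ) L_i}`
  set D : ℕ → ℂ := fun i => exp ((κ : ℂ) * Lg i) with hD_def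
  have hD0 : ∀ i, D i ≠ 0 := fun i => Complex.exp_ne_zero _
  have hDnorm : ∀ i, ‖D i‖ = Real.exp (κ * Real.log ‖z₀ i‖) := fun i => by
    simp only [hD_def]
    rw [Complex.norm_exp, Complex.re_ofReal_mul, hReL]
  set F : ℕ → ι → ℂ := fun i j =>
    exp (((((q j).natDegree : ℝ) + μ * e j - κ : ℝ) : ℂ) * Lg i) with hF_def
  have hFtop : ∀ i, ∀ j ∈ Jt, F i j = 1 := by
    intro i j hj
    obtain ⟨_, hjt⟩ := Finset.mem_filter.1 hj
    have h0 : ((q j).natDegree : ℝ) + μ * e j - κ = 0 := by linarith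
    simp only [hF_def, h0]
    simp
  have hFnorm : ∀ i j, ‖F i j‖ =
      Real.exp ((((q j).natDegree : ℝ) + μ * e j - κ) * Real.log ‖z₀ i‖) := by
    intro i j
    simp only [hF_def]
    rw [Complex.norm_exp, Complex.re_ofReal_mul, hReL]
  have hFmul : ∀ i j, z₀ i ^ (q j).natDegree * exp ((μ : ℂ) * Lg i) ^ (e j) = F i j * D i := by
    intro i j
    simp only [hF_def, hD_def]
    rw [← hLz i, ← Complex.exp_nat_mul, ← Complex.exp_nat_mul, ← Complex.exp_add,
      ← Complex.exp_add]
    congr 1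
    push_cast
    ring
  -- the rescaled functions `G_i(u) = g(φ_i(u)) / D_i`
  set g : ℂ → ℂ := fun z => (∑ j ∈ J, (q j).eval z * exp (R.eval z) ^ (e j)) + E z with hg_def
  set G : ℕ → ℂ → ℂ := fun i u => g (φ i u) / D i with hG_def
  have hgdiff : Differentiable ℂ g := by
    refine (Differentiable.fun_sum fun j _ => ?_).add hE
    exact (Polynomial.differentiable _).mul ((Polynomial.differentiable R).cexp.pow _)
  have hGdiff : ∀ i, Differentiable ℂ (G i) := by
    intro i
    have hφ : Differentiable ℂ (φ i) := differentiable_gcePhi R (z₀ i)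
    exact (hgdiff.comp hφ).div_const _
  -- the key identity `e^{R(φ u)} = θ e^{μL} e^{u + Rem u}`
  have hkey : ∀ i (u : ℂ), exp (R.eval (φ i u)) =
      θ * exp ((μ : ℂ) * Lg i) * exp (u + (R.eval (φ i u) - R.eval (z₀ i) - u)) := by
    intro i u
    rw [← hz₀θ i, ← Complex.exp_add]
    congr 1
    ring
  -- uniform approximation on `closedBall 0 1`
  obtain ⟨C, hC0, N, hC⟩ := hEb (|Real.log ‖θ‖| + 2 + |μ| / 8)
  set W : ℝ := ‖θ‖ * Real.exp 2 with hW
  set Nκ : ℕ := ⌈|κ|⌉₊ with hNκ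
  have hunif : ∀ η : ℝ, 0 < η → ∀ᶠ i in atTop, ∀ u ∈ closedBall (0 : ℂ) 1, ‖G i u - h u‖ < η := by
    intro η hη
    have hη4 : 0 < η / 4 := by positivity
    obtain ⟨β, hβ, hβh⟩ := Metric.uniformContinuousOn_iff.1
      ((isCompact_closedBall (0 : ℂ) 2).uniformContinuousOn_of_continuous hh.continuous.continuousOn)
      (η / 4) hη4
    have hevR : ∀ᶠ i in atTop, K / ‖z₀ i‖ < min β 1 :=
      (tendsto_const_nhds.div_atTop hz₀norm).eventually (gt_mem_nhds (lt_min hβ zero_lt_one))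
    -- the top coefficient-tail term
    have hevT : ∀ᶠ i in atTop, (∑ j ∈ Jt, Kq j * W ^ (e j)) / ‖z₀ i‖ < η / 4 :=
      (tendsto_const_nhds.div_atTop hz₀norm).eventually (gt_mem_nhds hη4)
    -- the non-top terms: power gap
    have hevN : ∀ᶠ i in atTop, ∑ j ∈ Jn, (‖(q j).leadingCoeff‖ + Kq j) *
        Real.exp ((((q j).natDegree : ℝ) + μ * e j - κ) * Real.log ‖z₀ i‖) * W ^ (e j) <
          η / 4 := by
      have hlim : Tendsto (fun i => ∑ j ∈ Jn, (‖(q j).leadingCoeff‖ + Kq j) *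
          Real.exp ((((q j).natDegree : ℝ) + μ * e j - κ) * Real.log ‖z₀ i‖) * W ^ (e j))
          atTop (𝓝 0) := by
        rw [show (0 : ℝ) = ∑ j ∈ Jn, 0 by simp]
        refine tendsto_finsetSum _ fun j hj => ?_
        obtain ⟨hjJ, hjn⟩ := Finset.mem_filter.1 hj
        have hγ : ((q j).natDegree : ℝ) + μ * e j - κ < 0 := by
          rcases (hκ j hjJ).lt_or_eq with hlt | heq
          · linarith
          · exact absurd heq hjn
        have h1 : Tendsto (fun i => Real.exp ((((q j).natDegree : ℝ) + μ * e j - κ) *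
            Real.log ‖z₀ i‖)) atTop (𝓝 0) :=
          Real.tendsto_exp_atBot.comp (hlog.const_mul_atTop_of_neg hγ)
        have h2 := (h1.const_mul (‖(q j).leadingCoeff‖ + Kq j)).mul_const (W ^ (e j))
        simpa using h2
      exact hlim.eventually (gt_mem_nhds hη4)
    -- the `E`-term
    have hevE : ∀ᶠ i in atTop,
        C * ((2 + 3 * Λ i) ^ (N + Nκ) * Real.exp (δ * (1 - (3 / 16) * Λ i))) <
          η / 4 := by
      have h1 := (tendsto_pow_mul_exp_escape hΛ (N + Nκ) hδ).const_mul C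
      rw [mul_zero] at h1
      exact h1.eventually (gt_mem_nhds hη4)
    filter_upwards [hevR, hevT, hevN, hevE] with i hiR hiT hiN hiE u hu
    rw [mem_closedBall, dist_zero_right] at hu
    set ρ : ℂ := R.eval (φ i u) - R.eval (z₀ i) - u with hρ_def
    have hRem1 : ‖ρ‖ < min β 1 := (hRem i u hu).trans_lt hiR
    have hRemβ : ‖ρ‖ < β := hRem1.trans_le (min_le_left _ _)
    have hRem1' : ‖ρ‖ ≤ 1 := (hRem1.trans_le (min_le_right _ _)).le
    have hw : ‖θ * exp (u + ρ)‖ ≤ W := by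
      rw [norm_mul, Complex.norm_exp, hW]
      refine mul_le_mul_of_nonneg_left (Real.exp_le_exp.2 ?_) (norm_nonneg _)
      have := re_le_norm (u + ρ)
      have := norm_add_le u ρ
      linarith
    have hz₀i1 : 1 ≤ ‖z₀ i‖ := hz₀1 i
    -- (1) the top term
    have hQterm : ‖Qμ.eval (θ * exp (u + ρ)) - h u‖ < η / 4 := by
      have hmem1 : u + ρ ∈ closedBall (0 : ℂ) 2 := by
        rw [mem_closedBall, dist_zero_right]
        exact (norm_add_le _ _).trans (by linarith)
      have hmem2 : u ∈ closedBall (0 : ℂ) 2 := by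
        rw [mem_closedBall, dist_zero_right]; linarith
      have hdist : dist (u + ρ) u < β := by
        rw [dist_eq_norm, add_sub_cancel_left]; exact hRemβ
      have := hβh _ hmem1 _ hmem2 hdist
      rwa [dist_eq_norm] at this
    -- (2) the top coefficient-tail term
    have hTterm : ‖∑ j ∈ Jt, ((q j).eval (φ i u) / z₀ i ^ (q j).natDegree - (q j).leadingCoeff) *
        (θ * exp (u + ρ)) ^ (e j)‖ < η / 4 := by
      refine lt_of_le_of_lt ?_ hiT
      rw [Finset.sum_div]
      refine (norm_sum_le _ _).trans (Finset.sum_le_sum fun j _ => ?_)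
      rw [norm_mul, norm_pow]
      calc ‖(q j).eval (φ i u) / z₀ i ^ (q j).natDegree - (q j).leadingCoeff‖ *
            ‖θ * exp (u + ρ)‖ ^ (e j)
          ≤ Kq j / ‖z₀ i‖ * W ^ (e j) :=
            mul_le_mul (hratio j i u hu) (pow_le_pow_left₀ (norm_nonneg _) hw (e j))
              (by positivity) (div_nonneg (hKq0 j) (norm_nonneg _))
        _ = Kq j * W ^ (e j) / ‖z₀ i‖ := by ring
    -- (3) the non-top terms
    have hNterm : ‖∑ j ∈ Jn, (q j).eval (φ i u) / z₀ i ^ (q j).natDegree * F i j *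
        (θ * exp (u + ρ)) ^ (e j)‖ < η / 4 := by
      refine lt_of_le_of_lt ?_ hiN
      refine (norm_sum_le _ _).trans (Finset.sum_le_sum fun j _ => ?_)
      rw [norm_mul, norm_mul, norm_pow, hFnorm]
      have hr : ‖(q j).eval (φ i u) / z₀ i ^ (q j).natDegree‖ ≤ ‖(q j).leadingCoeff‖ + Kq j := by
        have h1 := hratio j i u hu
        have h2 := norm_le_insert' ((q j).eval (φ i u) / z₀ i ^ (q j).natDegree)
          (q j).leadingCoeff
        have h3 : Kq j / ‖z₀ i‖ ≤ Kq j := div_le_self (hKq0 j) hz₀i1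
        linarith
      have hWpow : ‖θ * exp (u + ρ)‖ ^ (e j) ≤ W ^ (e j) :=
        pow_le_pow_left₀ (norm_nonneg _) hw (e j)
      have hlc0 : 0 ≤ ‖(q j).leadingCoeff‖ + Kq j := by have := hKq0 j; positivity
      exact mul_le_mul (mul_le_mul_of_nonneg_right hr (Real.exp_nonneg _)) hWpow
        (by positivity) (by positivity)
    -- (4) the `E`-term
    have hEterm : ‖E (φ i u) / D i‖ < η / 4 := by
      have hre1 : (φ i u).re ≤ (z₀ i).re + 1 := by
        have h1 := re_le_norm (φ i u - z₀ i)
        rw [Complex.sub_re] at h1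
        linarith [hdisp i u hu]
      have hre0 : (φ i u).re ≤ 0 := hre1.trans (hz₀nonpos i)
      have hnorm1 : 1 ≤ ‖φ i u‖ := by
        have h1 := norm_sub_norm_le (z₀ i) (φ i u)
        rw [norm_sub_rev] at h1
        linarith [hdisp i u hu, hz₀16 i]
      have hlr := abs_log_norm_sub_log_norm_le (hz₀16 i) (hdisp i u hu)
      have hReR : |(R.eval (φ i u)).re - μ * Real.log ‖φ i u‖| ≤ |Real.log ‖θ‖| + 2 + |μ| / 8 :=
        abs_re_sub_mul_log_le_window (by rw [hρ_def]; ring) (hz₀re i) hu hRem1' hlr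
      have h5 := hC _ hre0 hnorm1 hReR
      have hnorm : ‖φ i u‖ ≤ 1 + 3 * Λ i := by
        have := norm_le_insert' (φ i u) (z₀ i)
        linarith [hdisp i u hu, hz₀up i]
      -- `1/‖D‖ = e^{-κ log ‖z₀‖} ≤ e^{|κ| log ‖z₀‖} ≤ (2 + 3Λ)^{Nκ}`
      have hDinv : 1 / ‖D i‖ ≤ (2 + 3 * Λ i) ^ Nκ := by
        rw [hDnorm, one_div, ← Real.exp_neg]
        calc Real.exp (-(κ * Real.log ‖z₀ i‖)) ≤ Real.exp (|κ| * Real.log ‖z₀ i‖) := by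
              refine Real.exp_le_exp.2 ?_
              rw [← neg_mul]
              exact mul_le_mul_of_nonneg_right (neg_le_abs κ) (hlog0 i)
          _ ≤ (2 + 3 * Λ i) ^ Nκ :=
              exp_mul_log_le_pow (Nat.le_ceil _) hz₀i1 (by linarith [hz₀up i])
      have hDpos : 0 < ‖D i‖ := norm_pos_iff.2 (hD0 i)
      rw [norm_div, div_eq_mul_one_div]
      calc ‖E (φ i u)‖ * (1 / ‖D i‖)
          ≤ (C * (1 + ‖φ i u‖) ^ N * Real.exp (δ * (φ i u).re)) * (2 + 3 * Λ i) ^ Nκ :=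
            mul_le_mul h5 hDinv (by positivity) (by positivity)
        _ ≤ (C * (2 + 3 * Λ i) ^ N * Real.exp (δ * (1 - (3 / 16) * Λ i))) *
              (2 + 3 * Λ i) ^ Nκ := by
            refine mul_le_mul_of_nonneg_right ?_ (pow_nonneg (by linarith [hΛ0 i]) _)
            rw [mul_assoc, mul_assoc]
            refine mul_le_mul_of_nonneg_left ?_ hC0
            refine mul_le_mul (pow_le_pow_left₀ (by positivity) (by linarith) N)
              (Real.exp_le_exp.2 (mul_le_mul_of_nonneg_left (by linarith [hz₀neg i]) hδ.le))
              (Real.exp_nonneg _) (pow_nonneg (by linarith [hΛ0 i]) _)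
        _ = C * ((2 + 3 * Λ i) ^ (N + Nκ) *
              Real.exp (δ * (1 - (3 / 16) * Λ i))) := by
            rw [pow_add]; ring
        _ < η / 4 := hiE
    -- assemble: `G i u - h u = (top - h) + tails + non-top + E/D`
    have hterm : ∀ j ∈ J, (q j).eval (φ i u) * exp (R.eval (φ i u)) ^ (e j) / D i =
        (q j).eval (φ i u) / z₀ i ^ (q j).natDegree * F i j * (θ * exp (u + ρ)) ^ (e j) := by
      intro j _
      have hzn : z₀ i ^ (q j).natDegree ≠ 0 := pow_ne_zero _ (hz₀ne i)
      have e1 : (q j).eval (φ i u) = (q j).eval (φ i u) / z₀ i ^ (q j).natDegree *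
          z₀ i ^ (q j).natDegree := (div_mul_cancel₀ _ hzn).symm
      rw [hkey i u, ← hρ_def]
      conv_lhs => rw [e1]
      calc (q j).eval (φ i u) / z₀ i ^ (q j).natDegree * z₀ i ^ (q j).natDegree *
            (θ * exp ((μ : ℂ) * Lg i) * exp (u + ρ)) ^ (e j) / D i
          = (q j).eval (φ i u) / z₀ i ^ (q j).natDegree *
              (z₀ i ^ (q j).natDegree * exp ((μ : ℂ) * Lg i) ^ (e j)) *
              (θ * exp (u + ρ)) ^ (e j) / D i := by ring
        _ = (q j).eval (φ i u) / z₀ i ^ (q j).natDegree * (F i j * D i) *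
              (θ * exp (u + ρ)) ^ (e j) / D i := by rw [hFmul i j]
        _ = (q j).eval (φ i u) / z₀ i ^ (q j).natDegree * F i j *
              (θ * exp (u + ρ)) ^ (e j) * D i / D i := by ring
        _ = (q j).eval (φ i u) / z₀ i ^ (q j).natDegree * F i j *
              (θ * exp (u + ρ)) ^ (e j) := mul_div_cancel_right₀ _ (hD0 i)
    have hGsplit : G i u - h u = (Qμ.eval (θ * exp (u + ρ)) - h u) +
        (∑ j ∈ Jt, ((q j).eval (φ i u) / z₀ i ^ (q j).natDegree - (q j).leadingCoeff) *
          (θ * exp (u + ρ)) ^ (e j)) +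
        (∑ j ∈ Jn, (q j).eval (φ i u) / z₀ i ^ (q j).natDegree * F i j *
          (θ * exp (u + ρ)) ^ (e j)) +
        E (φ i u) / D i := by
      have hQμe : Qμ.eval (θ * exp (u + ρ)) =
          ∑ j ∈ Jt, (q j).leadingCoeff * (θ * exp (u + ρ)) ^ (e j) := by
        rw [hQμ, Polynomial.eval_finsetSum]
        refine Finset.sum_congr rfl fun j _ => ?_
        rw [Polynomial.eval_mul, Polynomial.eval_C, Polynomial.eval_pow, Polynomial.eval_X]
      have hsum : (∑ j ∈ J, (q j).eval (φ i u) * exp (R.eval (φ i u)) ^ (e j)) / D i =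
          (∑ j ∈ Jt, (q j).eval (φ i u) / z₀ i ^ (q j).natDegree * (θ * exp (u + ρ)) ^ (e j)) +
          ∑ j ∈ Jn, (q j).eval (φ i u) / z₀ i ^ (q j).natDegree * F i j *
            (θ * exp (u + ρ)) ^ (e j) := by
        rw [Finset.sum_div, Finset.sum_congr rfl hterm,
          ← Finset.sum_filter_add_sum_filter_not J
            (fun j => ((q j).natDegree : ℝ) + μ * e j = κ)]
        congr 1
        refine Finset.sum_congr rfl fun j hj => ?_
        rw [hFtop i j hj, mul_one]
      have htails : ∑ j ∈ Jt, (q j).eval (φ i u) / z₀ i ^ (q j).natDegree *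
          (θ * exp (u + ρ)) ^ (e j) =
          (∑ j ∈ Jt, ((q j).eval (φ i u) / z₀ i ^ (q j).natDegree - (q j).leadingCoeff) *
            (θ * exp (u + ρ)) ^ (e j)) +
          ∑ j ∈ Jt, (q j).leadingCoeff * (θ * exp (u + ρ)) ^ (e j) := by
        rw [← Finset.sum_add_distrib]
        refine Finset.sum_congr rfl fun j _ => ?_
        ring
      rw [hG_def, hg_def]
      simp only []
      rw [add_div, hsum, htails, ← hQμe]
      ring
    rw [hGsplit]
    calc ‖(Qμ.eval (θ * exp (u + ρ)) - h u) +
          (∑ j ∈ Jt, ((q j).eval (φ i u) / z₀ i ^ (q j).natDegree - (q j).leadingCoeff) *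
            (θ * exp (u + ρ)) ^ (e j)) +
          (∑ j ∈ Jn, (q j).eval (φ i u) / z₀ i ^ (q j).natDegree * F i j *
            (θ * exp (u + ρ)) ^ (e j)) +
          E (φ i u) / D i‖
        ≤ ‖Qμ.eval (θ * exp (u + ρ)) - h u‖ +
          ‖∑ j ∈ Jt, ((q j).eval (φ i u) / z₀ i ^ (q j).natDegree - (q j).leadingCoeff) *
            (θ * exp (u + ρ)) ^ (e j)‖ +
          ‖∑ j ∈ Jn, (q j).eval (φ i u) / z₀ i ^ (q j).natDegree * F i j *
            (θ * exp (u + ρ)) ^ (e j)‖ +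
          ‖E (φ i u) / D i‖ := by
          refine (norm_add_le _ _).trans (add_le_add ?_ le_rfl)
          exact norm_add₃_le
      _ < η / 4 + η / 4 + η / 4 + η / 4 := by gcongr
      _ = η := by ring
  -- persistence
  have hzeros := eventually_exists_zero_of_unif_approx hh hhne hh0 hGdiff zero_lt_one hunif
  obtain ⟨K₁, hK₁⟩ := eventually_atTop.1 hzeros
  have hsol : ∀ k : ℕ, ∃ u : ℂ, ‖u‖ ≤ 1 ∧ G (k + K₁) u = 0 := by
    intro k
    obtain ⟨u, hu, hu0⟩ := hK₁ (k + K₁) (Nat.le_add_left _ _)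
    rw [mem_ball, dist_zero_right] at hu
    exact ⟨u, hu.le, hu0⟩
  choose u hu1 hu0 using hsol
  refine ⟨fun k => φ (k + K₁) (u k), fun k => (3 / 16) * Λ (k + K₁) - 1,
    ?_, fun k => ⟨?_, ?_, ?_⟩⟩
  · refine tendsto_atTop_add_const_right _ (-1) ?_
    exact (hΛ.comp (tendsto_add_atTop_nat K₁)).const_mul_atTop (by norm_num : (0 : ℝ) < 3 / 16)
  · have h0 := hu0 k
    have : g (φ (k + K₁) (u k)) = 0 := by
      rw [hG_def] at h0
      exact (div_eq_zero_iff.1 h0).resolve_right (hD0 _)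
    simpa [hg_def] using this
  · have h1 := re_le_norm (φ (k + K₁) (u k) - z₀ (k + K₁))
    rw [Complex.sub_re] at h1
    have h2 := hdisp (k + K₁) (u k) (hu1 k)
    have h3 := hz₀neg (k + K₁)
    linarith
  · have h1 := norm_le_insert' (φ (k + K₁) (u k)) (z₀ (k + K₁))
    have h2 := hdisp (k + K₁) (u k) (hu1 k)
    have h3 := hz₀up (k + K₁)
    linarith

end Summit.Schanuel.Schanuel.Theorems
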